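import Summits.Ventures.HodgeRepro2.T5QuadraticGenerator
import Summits.Ventures.HodgeRepro2.T5QuadraticPlaceTrichotomy

/-!
# T5QuadraticInertBridge — N3's LOCAL sorting «`v` inert: `E_v/F_v` unramified quadratic» IS
# «`v` stays prime» IS the Legendre condition

Tier-5 kernel support (seat p8, blind lane; sub-step N3).  The record sorts the finite places `v`
of `F` by the LOCAL behaviour of `E_v/F_v` alone (route-2, STATUS l. 12109: N3 writes no global
generator, no Legendre symbol): `v` is inert when `E_v/F_v` is the unramified quadratic extension,
i.e. there is a unique place `w ∣ v` with `e(w/v) = 1` and `f(w/v) = 2`.  T5-157 derived that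
local picture from «`v` stays prime» (`v 𝓞_E = w`).  This file proves the CONVERSE and closes the
loop with the census of T5-173 … T5-177:

* `map_eq_asIdeal_of_unique_of_ramificationIdx'_eq_one` — a unique `w ∣ v` with `e(w/v) = 1`
  forces `v 𝓞_L = w` (the factorisation of `v 𝓞_L` is `w^{e}` with `e = 1`);
* `staysPrime_iff_unique_unramified` — for `[L : K] = 2`: «`v` stays prime» ⟺ «a unique `w ∣ v`
  with `e = 1`, `f = 2`» (N3's local «inert»);
* `unique_unramified_iff_not_isSquare` — for `4d ∉ v`: N3's local «inert» ⟺ `d` is not a square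
  modulo `v`; and `exists_census_local` / `exists_census_local_cm` — the same for every quadratic
  `L/K` and every CM field, with the `d` of T5-177.

No `sorry`, no axiom beyond `propext`, `Classical.choice`, `Quot.sound`.
-/

namespace Summit.Ventures.HodgeRepro2.T5QuadraticInertBridge

open Polynomial NumberField IsDedekindDomain HeightOneSpectrum UniqueFactorizationMonoid

variable {K : Type*} [Field K] [NumberField K] {L : Type*} [Field L] [NumberField L] [Algebra K L]
  (v : HeightOneSpectrum (𝓞 K))

/-- Every prime factor of `v 𝓞_L` is the ideal of a finite place of `L` lying over `v`. -/
theorem exists_eq_asIdeal_of_mem_normalizedFactors {P : Ideal (𝓞 L)}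
    (hP : P ∈ normalizedFactors (v.asIdeal.map (algebraMap (𝓞 K) (𝓞 L)))) :
    ∃ w : HeightOneSpectrum (𝓞 L), w.asIdeal.LiesOver v.asIdeal ∧ P = w.asIdeal := by
  have hprime : Prime P := prime_of_normalized_factor P hP
  have hle : v.asIdeal.map (algebraMap (𝓞 K) (𝓞 L)) ≤ P :=
    Ideal.le_of_dvd (dvd_of_mem_normalizedFactors hP)
  haveI : P.IsPrime := (Ideal.prime_iff_isPrime hprime.ne_zero).mp hprime
  exact ⟨⟨P, inferInstance, hprime.ne_zero⟩, T5QuadraticSplitRamified.liesOver_of_map_le v hle, rfl⟩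

/-- **The converse of T5-157**: if `w` is the unique finite place of `L` over `v` and
`e(w/v) = 1`, then `v 𝓞_L = w` («`v` stays prime»): the factorisation of `v 𝓞_L` is `w^{e(w/v)}`. -/
theorem map_eq_asIdeal_of_unique_of_ramificationIdx'_eq_one (w : HeightOneSpectrum (𝓞 L))
    [w.asIdeal.LiesOver v.asIdeal]
    (huniq : ∀ w' : HeightOneSpectrum (𝓞 L), w'.asIdeal.LiesOver v.asIdeal → w' = w)
    (he : v.asIdeal.ramificationIdx' w.asIdeal = 1) :
    v.asIdeal.map (algebraMap (𝓞 K) (𝓞 L)) = w.asIdeal := by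
  classical
  have hne : v.asIdeal.map (algebraMap (𝓞 K) (𝓞 L)) ≠ ⊥ :=
    T5QuadraticKummerDedekind.map_ne_bot v.ne_bot
  have hall : ∀ P ∈ normalizedFactors (v.asIdeal.map (algebraMap (𝓞 K) (𝓞 L))), P = w.asIdeal := by
    intro P hP
    obtain ⟨w', hw', rfl⟩ := exists_eq_asIdeal_of_mem_normalizedFactors v hP
    rw [huniq w' hw']
  have hcount : Multiset.count w.asIdeal
      (normalizedFactors (v.asIdeal.map (algebraMap (𝓞 K) (𝓞 L)))) = 1 := by
    rw [← Ideal.IsDedekindDomain.ramificationIdx_eq_normalizedFactors_count v.asIdeal w.asIdeal hne,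
      ← Ideal.ramificationIdx'_eq_ramificationIdx v.asIdeal w.asIdeal v.ne_bot, he]
  have hcard : (normalizedFactors (v.asIdeal.map (algebraMap (𝓞 K) (𝓞 L)))).card = 1 := by
    rw [← hcount]
    exact (Multiset.count_eq_card.mpr fun P hP => (hall P hP).symm).symm
  have hnf : normalizedFactors (v.asIdeal.map (algebraMap (𝓞 K) (𝓞 L))) = {w.asIdeal} := by
    rw [← Multiset.replicate_one]
    exact Multiset.eq_replicate.mpr ⟨hcard, hall⟩
  have hprod := prod_normalizedFactors hne
  rw [hnf, Multiset.prod_singleton, associated_iff_eq] at hprod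
  exact hprod.symm

omit [NumberField K] in
/-- Uniqueness of the place over `v` when `v 𝓞_L = w`. -/
theorem eq_of_liesOver_of_map_eq (w : HeightOneSpectrum (𝓞 L))
    (hmap : v.asIdeal.map (algebraMap (𝓞 K) (𝓞 L)) = w.asIdeal) (w' : HeightOneSpectrum (𝓞 L))
    [hw' : w'.asIdeal.LiesOver v.asIdeal] : w' = w := by
  have hle : v.asIdeal.map (algebraMap (𝓞 K) (𝓞 L)) ≤ w'.asIdeal := by
    rw [Ideal.map_le_iff_le_comap, ← Ideal.under_def]
    exact (Ideal.over_def w'.asIdeal v.asIdeal).le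
  rw [hmap] at hle
  exact HeightOneSpectrum.ext (w.isMaximal.eq_of_le w'.isPrime.ne_top hle).symm

/-- **N3's local «inert» ⟺ «`v` stays prime»** (for `[L : K] = 2`): there is a unique place
`w ∣ v` with `e(w/v) = 1` and `f(w/v) = 2` iff `v 𝓞_L = w` for some `w`. -/
theorem staysPrime_iff_unique_unramified (h2 : Module.finrank K L = 2) :
    (∃ w : HeightOneSpectrum (𝓞 L), v.asIdeal.map (algebraMap (𝓞 K) (𝓞 L)) = w.asIdeal) ↔
      ∃ w : HeightOneSpectrum (𝓞 L), w.asIdeal.LiesOver v.asIdeal ∧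
        (∀ w' : HeightOneSpectrum (𝓞 L), w'.asIdeal.LiesOver v.asIdeal → w' = w) ∧
        v.asIdeal.ramificationIdx' w.asIdeal = 1 ∧ v.asIdeal.inertiaDeg' w.asIdeal = 2 := by
  constructor
  · rintro ⟨w, hw⟩
    haveI := w.isPrime
    haveI : w.asIdeal.LiesOver v.asIdeal := T5QuadraticSplitRamified.liesOver_of_map_le v hw.le
    refine ⟨w, inferInstance, fun w' hw' => eq_of_liesOver_of_map_eq v w hw w', ?_, ?_⟩
    · exact T5InertGlobalPrime.ramificationIdx'_eq_one_of_staysPrime v w hw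
    · rw [T5InertGlobalPrime.inertiaDeg'_eq_finrank_of_staysPrime v w hw, h2]
  · rintro ⟨w, hw, huniq, he, -⟩
    exact ⟨w, map_eq_asIdeal_of_unique_of_ramificationIdx'_eq_one v w huniq he⟩

/-- **N3's local «inert» ⟺ the Legendre condition** (`x² = d`, `x ∉ 𝓞_K`, `[L : K] = 2`, `4d ∉ v`):
there is a unique place `w ∣ v` with `e(w/v) = 1`, `f(w/v) = 2` iff `d` is not a square mod `v`. -/
theorem unique_unramified_iff_not_isSquare {x : 𝓞 L} {d : 𝓞 K} (h2 : Module.finrank K L = 2)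
    (hx : x * x = algebraMap (𝓞 K) (𝓞 L) d) (hx' : x ∉ Set.range (algebraMap (𝓞 K) (𝓞 L)))
    (hv : 4 * d ∉ v.asIdeal) :
    (∃ w : HeightOneSpectrum (𝓞 L), w.asIdeal.LiesOver v.asIdeal ∧
        (∀ w' : HeightOneSpectrum (𝓞 L), w'.asIdeal.LiesOver v.asIdeal → w' = w) ∧
        v.asIdeal.ramificationIdx' w.asIdeal = 1 ∧ v.asIdeal.inertiaDeg' w.asIdeal = 2) ↔
      ¬ IsSquare (Ideal.Quotient.mk v.asIdeal d) := by
  rw [← staysPrime_iff_unique_unramified v h2]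
  exact T5QuadraticConductor.exists_map_eq_asIdeal_iff_not_isSquare v h2 hx hx' hv

/-- The local census for every quadratic `L/K`: with the `d` of T5-177, at every `v` with
`4d ∉ v`, N3's local «inert» holds iff `d` is not a square modulo `v`. -/
theorem exists_census_local (h2 : Module.finrank K L = 2) :
    ∃ d : 𝓞 K, ∀ v : HeightOneSpectrum (𝓞 K), 4 * d ∉ v.asIdeal →
      ((∃ w : HeightOneSpectrum (𝓞 L), w.asIdeal.LiesOver v.asIdeal ∧
          (∀ w' : HeightOneSpectrum (𝓞 L), w'.asIdeal.LiesOver v.asIdeal → w' = w) ∧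
          v.asIdeal.ramificationIdx' w.asIdeal = 1 ∧ v.asIdeal.inertiaDeg' w.asIdeal = 2) ↔
        ¬ IsSquare (Ideal.Quotient.mk v.asIdeal d)) := by
  obtain ⟨x, d, hx, hx'⟩ := T5QuadraticGenerator.exists_sq_eq_algebraMap h2
  exact ⟨d, fun v hv => unique_unramified_iff_not_isSquare v h2 hx hx' hv⟩

/-- The local census of a CM field `E` over `E⁺` (Mathlib's `NumberField.IsCMField`): there is
`d ∈ 𝓞_{E⁺}` such that at every finite place `v` of `E⁺` with `4d ∉ v`, `v` is inert in `E` in the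
record's LOCAL sense (a unique `w ∣ v`, `e = 1`, `f = 2`) iff `d` is not a square modulo `v`. -/
theorem exists_census_local_cm (E : Type*) [Field E] [NumberField E] [IsCMField E] :
    ∃ d : 𝓞 (maximalRealSubfield E), ∀ v : HeightOneSpectrum (𝓞 (maximalRealSubfield E)),
      4 * d ∉ v.asIdeal →
        ((∃ w : HeightOneSpectrum (𝓞 E), w.asIdeal.LiesOver v.asIdeal ∧
            (∀ w' : HeightOneSpectrum (𝓞 E), w'.asIdeal.LiesOver v.asIdeal → w' = w) ∧
            v.asIdeal.ramificationIdx' w.asIdeal = 1 ∧ v.asIdeal.inertiaDeg' w.asIdeal = 2) ↔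
          ¬ IsSquare (Ideal.Quotient.mk v.asIdeal d)) :=
  exists_census_local (K := maximalRealSubfield E) (L := E)
    (T5CMInertPlacePackage.finrank_eq_two_cm E)

end Summit.Ventures.HodgeRepro2.T5QuadraticInertBridge
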